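import Mathlib
import Summits.Ventures.PercRepro2.SwOutNeverCore

/-!
# An instance of the vertex-separation criterion (blind cell PercRepro2, night-4 g28,
2026-08-28; proofs/NIGHT4-G28.md §8)

`ex7v` — `l = 0`, `h = 1`, `o = 2`; `h` has the single neighbour `3`, joined to `l`; behind `3` the
triangle `3–4, 3–5, 4–5` with `4, 5` joined to `6`, which is joined to `l`.  The junctions `4, 5`
(no edge to `l`, adjacent to each other) are joined to `h` by two edge-disjoint paths of `G − l`
(`1–3–4` and `1–3–5–4`), so no edge separates them (the bridge theorem does not apply; the
junction theorems of record admit neither two adjacent junctions nor these arms), but the VERTEX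
`3` — which carries an outside edge, hence is never a core — does: **`sw_ex7v : Sw ex7v 0 1 2`**
by `sw_of_neverCore`.
-/

namespace Summit.Ventures.PercRepro2

namespace LocRows

open Hull

open scoped Classical

/-- `l = 0`, `h = 1`, `o = 2`; edges `1–3, 3–0, 3–4, 3–5, 4–5, 4–6, 5–6, 6–0, 2–0`. -/
def ex7v : Fin 9 → Sym2 (Fin 7)
  | 0 => s(1, 3) | 1 => s(3, 0) | 2 => s(3, 4) | 3 => s(3, 5) | 4 => s(4, 5) | 5 => s(4, 6)
  | 6 => s(5, 6) | 7 => s(6, 0) | 8 => s(2, 0)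

/-- In `G − l` without the vertex `3`, the component of `h = 1` is `{1}`. -/
lemma ex7v_cluster_avoid : cluster ex7v (avoidConfig ex7v ({0}ᶜ) 3) 1 ⊆ {1} := by
  refine cluster_avoid_subset (by simp) ?_
  intro e x y hexy hin hx
  simp only [Set.mem_singleton_iff] at hx ⊢
  obtain ⟨a, ha, b, hb, hab⟩ := hin
  simp only [Set.mem_sdiff, Set.mem_compl_iff, Set.mem_singleton_iff] at ha hb
  fin_cases e
  all_goals simp only [ex7v, Sym2.eq_iff] at hexy hab
  all_goals omega

/-- The vertex `3` is never a core (it carries the outside edge `3–0`). -/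
lemma ex7v_neverCore_3 : NeverCore ex7v ({0}ᶜ) 1 2 3 :=
  NeverCore.out 3 1 0 rfl (by simp)

/-- **Row (SW) on `ex7v`**: the junctions `4, 5` are separated from `h` by the vertex `3`. -/
theorem sw_ex7v : Sw ex7v 0 1 2 := by
  refine sw_of_neverCore (by decide) ?_ ?_
  · intro e; fin_cases e <;> decide
  · intro x hx0 hx1 hx2
    fin_cases x
    · exact absurd rfl hx0
    · exact absurd rfl hx1
    · exact absurd rfl hx2
    · exact ex7v_neverCore_3
    · refine NeverCore.vertex 4 3 ex7v_neverCore_3 (by decide) (by decide) fun h => ?_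
      have := ex7v_cluster_avoid h
      simp at this
    · refine NeverCore.vertex 5 3 ex7v_neverCore_3 (by decide) (by decide) fun h => ?_
      have := ex7v_cluster_avoid h
      simp at this
    · exact NeverCore.out 6 7 0 rfl (by simp)

end LocRows

end Summit.Ventures.PercRepro2
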